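import Literature.NumberTheory.GaloisCohomology.Howard2004.DVRKolyvaginBoundAssemblyProofs
import Literature.NumberTheory.GaloisCohomology.Howard2004.DVRLevelTorsionControlProofs
import Literature.Algebra.Module.PairedTorsionModulesAlternating
import HarnessLib

/-!
# Howard 2004, Theorem 1.6.1 — «`ε ∈ {0,1}` is independent of `k`» DERIVED: the conclusion record from the
# PER-LEVEL output of Thm. 1.4.2 (arXiv:1202.6340, p. 11 L33–38 with Prop. 2.5.5, p. 10 L67–75) — proofs file

Source: B. Howard, *The Heegner point Kolyvagin system*, Compositio Math. **140** (2004), proof of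
Thm. 1.6.1 (= arXiv:1202.6340 Thm. 2.6.1), p. 11 L33–38: «By Remark 1.3.1 the Selmer triple
`(T^{(k)}, F, 𝓛^{(k)})` satisfies hypotheses H.0–H.5, and we may invoke the definitions and results of the
preceding section.  In particular … we have a decomposition
`H¹_{F(n)}(K, T^{(k)}) ≅ R^{(k),ε} ⊕ M^{(k)}(n) ⊕ M^{(k)}(n)` in which `ε ∈ {0,1}` is independent of both `n`
and `k` (by Lemma 1.5.3).»  Thm. 1.4.2 ALONE gives, at each level `k`, SOME `ε_k ∈ {0,1}`; the independence
of `k` is Prop. 1.5.5 («`ε ≡ ρ (mod 2)`», `ε + 2·dim M[𝔪] = dim H¹_F[𝔪]`) together with Lemma 1.3.3 (the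
`𝔪`-torsion of every level is `H¹_F(K, T̄)`).  The files `DVRKolyvaginBoundClosingProofs` /
`DVRKolyvaginBoundAssemblyProofs` consume the package with ONE `ε`; THIS FILE removes that residual
cross-level clause, so that the levelwise input of the tree's reduction of `thm161_dvrKolyvaginBound` is
EXACTLY the per-level statement of Thm. 1.4.2 (with «we may assume `ε ∈ {0,1}`»):

* §1 **`DVRSetting.exists_uniform_package_of_levelwise`** — from per-level additive `R`-equivariant
  bijections `θ_k : H¹_F(K, T^{(k)}) ≃ (Fin ε_k → R/𝔪^{e_k}) × (M_k × M_k)`, `ε_k ≤ 1`, `M_k` finite, ONE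
  `ε₀ ≤ 1` and bijections of the same kind with `Fin ε₀` for every `k` (same `M_k`).  Proof: the `R`-LINEAR maps
  `g_k = θ_{k+1} ∘ H¹(inc_k) ∘ θ_k⁻¹` between the genuine `R`-modules `(Fin ε_k → R/𝔪^{e_k}) × (M_k × M_k)`
  restrict to ISOMORPHISMS of the `π`-torsions (injective: `DVRSetting.incH1_injective`; onto: the one-step
  control `DVRSetting.exists_mem_selmerGroup_incH1_eq_iff` of `DVRLevelTorsionControlProofs`, `e_k ≥ 1`) —
  this is «all `≅ H¹_F(K, T̄)`» in the tree's currency — and the pure algebra is w7's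
  `Literature.Algebra.Module.exists_uniform_epsilon_of_torsionBy_linearEquiv` (Prop. 1.5.5's count;
  `dim (R/𝔪^{e_k})[π] = 1` by `finrank_torsionBy_quotient_maximalIdeal_pow`).  No `R`-module structure on
  cohomology is used: equivariance is carried through `scalarMapH1` (tree p664545 `AdicTower.incH1_scalarMapH1`).
* §2 **`DVRSetting.conclusion_of_levelwise_package`** — `S.Conclusion hy κ.one` from the PER-LEVEL package
  (`ε : ℕ → ℕ`) + Lemma 1.6.4 at `n = 1` + `κ_1 ≠ 0` (= `conclusion_of_package` ∘ §1).
* §3 **`DVRSetting.conclusion_of_exists_levelwise_package`** — the same from the EXISTENTIAL per-level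
  statements (the shape of two Literature named facts: «for every `k` there exist `ε ≤ 1`, a finite `M` and an
  `R`-equivariant `θ`», and «for every such decomposition at level `k`, `κ_1^{(k)} ∈ π^{len M} · H¹_F(K, T^{(k)})`»):
  `choose` + §2.
* §4 **`DVRSetting.epsilon_eq_and_length_eq_of_two_decompositions`** — `ε` and `len_R M` are invariants of
  the level (two `R`-equivariant decompositions have the same `ε` and the same `len M`; Prop. 1.5.5's count and
  additivity of length), so Def. 1.5.4 (`λ^{(k)}`, `Stub^{(k)}`) is well posed and the «for every
  decomposition» typing of Lemma 1.6.4 in §3 is equivalent to the printed one.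

HONEST FRAMING: `thm161_dvrKolyvaginBound` is NOT proved here; after this file the tree's reduction of it
rests on EXACTLY Thm. 1.4.2 (per level, printed shape) and Lemma 1.6.4 at `n = 1` (for every decomposition),
plus `κ_1 ≠ 0` and H.0–H.5.  No summit statement is proved; the Birch–Swinnerton-Dyer conjecture is not
proved by any of this.  No `sorry`, no new axiom, no instance, no notation, no definition, no named fact.
-/

set_option autoImplicit false

noncomputable section

open Function NumberField IsDedekindDomain Field
open scoped NumberField ContRepresentation Classical

namespace Literature.NumberTheory.GaloisCohomology.Howard2004

open Literature.NumberTheory.GaloisRepresentations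
open Literature.NumberTheory.GaloisRepresentations.DiscreteGaloisModule

namespace DVRSetting

variable {p : ℕ} [Fact p.Prime] {K : Type} [Field K] [NumberField K]
  {R : Type} [CommRing R] [IsDomain R] [IsDiscreteValuationRing R] [Algebra ℤ_[p] R]
  {N : ℕ → Type} [∀ k, AddCommGroup (N k)] [∀ k, TopologicalSpace (N k)]
  [∀ k, DiscreteTopology (N k)] [∀ k, Module R (N k)]
  {Rk : ℕ → Type} [∀ k, CommRing (Rk k)] [∀ k, IsLocalRing (Rk k)] [∀ k, TopologicalSpace (Rk k)]
  [∀ k, DiscreteTopology (Rk k)] [∀ k, Algebra ℤ_[p] (Rk k)] [∀ k, Algebra R (Rk k)]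
  [∀ k, Module (Rk k) (N k)] [∀ k, IsScalarTower R (Rk k) (N k)]
  {Nbar : Type} [AddCommGroup Nbar] [TopologicalSpace Nbar] [DiscreteTopology Nbar]
  [∀ k, Module (Rk k) Nbar]
  {Nq : ℕ → Finset (HeightOneSpectrum (𝓞 K)) → Type} [∀ k n, AddCommGroup (Nq k n)]
  [∀ k n, TopologicalSpace (Nq k n)] [∀ k n, DiscreteTopology (Nq k n)]
  [∀ k n, Module (Rk k) (Nq k n)] [∀ k n, Module R (Nq k n)]
  [∀ k n, IsScalarTower R (Rk k) (Nq k n)]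

/-! ## §1 ONE `ε` for all levels (Prop. 1.5.5 + Lemma 1.3.3) -/

/-- **«`ε ∈ {0,1}` is independent of `k`» on a `DVRSetting` with H.0–H.5.**  If every level Selmer group
`H¹_F(K, T^{(k)})` carries an additive `R`-equivariant bijection `θ_k` onto
`(Fin ε_k → R/𝔪^{e_k}) × (M_k × M_k)` with `ε_k ≤ 1` and `M_k` finite (Thm. 1.4.2 at level `k`, «we may
assume `ε ∈ {0,1}`»), then ONE `ε₀ ≤ 1` serves for every level (with the same `M_k`): the maps
`θ_{k+1} ∘ H¹(inc_k) ∘ θ_k⁻¹` are `R`-linear injections identifying the `π`-torsions (Lemma 1.3.3 for the levels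
`(k, k+1)`: `DVRSetting.exists_mem_selmerGroup_incH1_eq_iff`, `DVRSetting.incH1_injective`, `e_k ≥ 1`), and
`ε_k ≡ dim (level `k`)[π] (mod 2)` (Prop. 1.5.5, w7's `exists_uniform_epsilon_of_torsionBy_linearEquiv`).
[cite: Howard2004HeegnerKolyvagin, Prop. 1.5.5 and Thm. 1.6.1, proof (arXiv Prop. 2.5.5 p. 10 L67–75; p. 11 L33–38)] -/
theorem exists_uniform_package_of_levelwise (S : DVRSetting p K R N Rk Nbar Nq) (hy : S.SatisfiesH)
    {ε : ℕ → ℕ} (hε : ∀ k, ε k ≤ 1)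
    {M : ℕ → Type} [∀ k, AddCommGroup (M k)] [∀ k, Module R (M k)] [∀ k, Finite (M k)]
    (θ : ∀ k, ↥(((S.t k).cond).selmerGroup) ≃+
      ((Fin (ε k) → R ⧸ IsLocalRing.maximalIdeal R ^ S.e k) × (M k × M k)))
    (hθ : ∀ k (r : R) (y : galoisCohomology (S.T.ρ k) 1) (hy' : y ∈ ((S.t k).cond).selmerGroup),
      θ k ⟨galoisCohomology.scalarMapH1 (S.T.ρ k) (S.T.hlin k) r y,
          S.scalarMapH1_mem_selmerGroup hy k r hy'⟩ = r • θ k ⟨y, hy'⟩) :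
    ∃ (ε₀ : ℕ) (_ : ε₀ ≤ 1) (θ' : ∀ k, ↥(((S.t k).cond).selmerGroup) ≃+
        ((Fin ε₀ → R ⧸ IsLocalRing.maximalIdeal R ^ S.e k) × (M k × M k))),
      ∀ k (r : R) (y : galoisCohomology (S.T.ρ k) 1) (hy' : y ∈ ((S.t k).cond).selmerGroup),
        θ' k ⟨galoisCohomology.scalarMapH1 (S.T.ρ k) (S.T.hlin k) r y,
            S.scalarMapH1_mem_selmerGroup hy k r hy'⟩ = r • θ' k ⟨y, hy'⟩ := by
  have hπm : S.π ∈ IsLocalRing.maximalIdeal R := S.π_mem_maximalIdeal hy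
  have hle : ∀ k, S.e k ≤ S.e (k + 1) := S.e_le_succ hy
  have hirr : Irreducible S.π := (IsDiscreteValuationRing.irreducible_iff_uniformizer S.π).mpr hy.unif
  have he1 : ∀ k, 1 ≤ S.e k := fun k => hy.e_zero.trans_le (hy.e_strictMono.monotone (Nat.zero_le k))
  -- shorthands
  let G : ℕ → Type := fun j => galoisCohomology (S.T.ρ j) 1
  let sM : ∀ j, R → G j →+ G j := fun j r => galoisCohomology.scalarMapH1 (S.T.ρ j) (S.T.hlin j) r
  let inc : ∀ k, G k →+ G (k + 1) := fun k => S.T.incH1 S.π S.e hy.killed hy.ker_red hπm hle k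
  let L : ℕ → Type := fun k => (Fin (ε k) → R ⧸ IsLocalRing.maximalIdeal R ^ S.e k) × (M k × M k)
  have inc_sM : ∀ k (r : R) (c : G k), inc k (sM k r c) = sM (k + 1) r (inc k c) := fun k r c =>
    AdicTower.incH1_scalarMapH1 S.T S.π S.e hy.killed hy.ker_red hπm hle k r c
  have inc_inj : ∀ k, Function.Injective (inc k) := fun k => S.incH1_injective hy hπm hle k
  have inc_mem : ∀ k (c : G k), c ∈ ((S.t k).cond).selmerGroup →
      inc k c ∈ ((S.t (k + 1)).cond).selmerGroup := fun k c hc => S.incH1_mem_selmerGroup hy hπm hle k hc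
  -- the inverse structures are `R`-equivariant
  have symm_smul : ∀ (k : ℕ) (r : R) (y : L k),
      (((θ k).symm (r • y) : ↥(((S.t k).cond).selmerGroup)) : G k) =
        sM k r (((θ k).symm y : ↥(((S.t k).cond).selmerGroup)) : G k) := by
    intro k r y
    have h := hθ k r ((θ k).symm y).1 ((θ k).symm y).2
    rw [Subtype.coe_eta, AddEquiv.apply_symm_apply] at h
    have h2 := congrArg (θ k).symm h
    rw [AddEquiv.symm_apply_apply] at h2
    exact (congrArg Subtype.val h2).symm
  -- `g_k = θ_{k+1} ∘ H¹(inc_k) ∘ θ_k⁻¹`, an `R`-linear injection `L k → L (k+1)`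
  let g : ∀ k, L k →ₗ[R] L (k + 1) := fun k =>
    { toFun := fun y => θ (k + 1) ⟨inc k ((θ k).symm y).1, inc_mem k _ ((θ k).symm y).2⟩
      map_add' := fun y z => by
        rw [← map_add]
        congr 1
        apply Subtype.ext
        change inc k ((θ k).symm (y + z)).1 = inc k ((θ k).symm y).1 + inc k ((θ k).symm z).1
        rw [map_add, AddSubgroup.coe_add, map_add]
      map_smul' := fun r y => by
        rw [RingHom.id_apply, ← hθ (k + 1) r _ (inc_mem k _ ((θ k).symm y).2)]
        congr 1
        apply Subtype.ext
        change inc k ((θ k).symm (r • y)).1 = sM (k + 1) r (inc k ((θ k).symm y).1)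
        rw [symm_smul, inc_sM] }
  have g_apply : ∀ k (y : L k),
      g k y = θ (k + 1) ⟨inc k ((θ k).symm y).1, inc_mem k _ ((θ k).symm y).2⟩ := fun _ _ => rfl
  have g_inj : ∀ k, Function.Injective (g k) := fun k y z h => by
    rw [g_apply, g_apply] at h
    have h1 := congrArg Subtype.val ((θ (k + 1)).injective h)
    exact (θ k).symm.injective (Subtype.ext (inc_inj k h1))
  -- the restriction of `g_k` to the `π`-torsions is a bijection (Lemma 1.3.3 for the levels `(k, k+1)`)
  have g_mem : ∀ k, ∀ y ∈ Submodule.torsionBy R (L k) S.π,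
      g k y ∈ Submodule.torsionBy R (L (k + 1)) S.π := fun k y hy0 => by
    rw [Submodule.mem_torsionBy_iff] at hy0 ⊢
    rw [← LinearMap.map_smul, hy0, map_zero]
  let gt : ∀ k, ↥(Submodule.torsionBy R (L k) S.π) →ₗ[R] ↥(Submodule.torsionBy R (L (k + 1)) S.π) :=
    fun k => (g k).restrict (g_mem k)
  have gt_bij : ∀ k, Function.Bijective (gt k) := by
    intro k
    constructor
    · intro y z h
      exact Subtype.ext (g_inj k (congrArg Subtype.val h))
    · rintro ⟨z, hz⟩
      rw [Submodule.mem_torsionBy_iff] at hz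
      -- `c := θ_{k+1}⁻¹ z ∈ H¹_F(K, T^{(k+1)})` is killed by `π`, hence by `π^{e_k}`
      set c : ↥(((S.t (k + 1)).cond).selmerGroup) := (θ (k + 1)).symm z with hc
      have hcπ : sM (k + 1) S.π c.1 = 0 := by
        have h := symm_smul (k + 1) S.π z
        rw [hz, map_zero] at h
        exact h.symm.trans rfl
      have hcπe : galoisCohomology.scalarMapH1 (S.T.ρ (k + 1)) (S.T.hlin (k + 1)) (S.π ^ S.e k) c.1 = 0 := by
        rw [← Nat.sub_add_cancel (he1 k), pow_succ, galoisCohomology.scalarMapH1_mul,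
          AddMonoidHom.comp_apply]
        change galoisCohomology.scalarMapH1 _ _ _ (sM (k + 1) S.π c.1) = 0
        rw [hcπ, map_zero]
      obtain ⟨c', hc', hinc⟩ :=
        (S.exists_mem_selmerGroup_incH1_eq_iff hy hπm hle k c.1).2 ⟨c.2, hcπe⟩
      -- `y := θ_k c'` is `π`-torsion and `g_k y = z`
      have hc'π : sM k S.π c' = 0 := inc_inj k (by
        rw [inc_sM, map_zero, show inc k c' = c.1 from hinc, hcπ])
      refine ⟨⟨θ k ⟨c', hc'⟩, ?_⟩, Subtype.ext ?_⟩
      · rw [Submodule.mem_torsionBy_iff, ← hθ k S.π c' hc']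
        have h0 : (⟨galoisCohomology.scalarMapH1 (S.T.ρ k) (S.T.hlin k) S.π c',
            S.scalarMapH1_mem_selmerGroup hy k S.π hc'⟩ : ↥(((S.t k).cond).selmerGroup)) = 0 :=
          Subtype.ext hc'π
        rw [h0, map_zero]
      · change g k (θ k ⟨c', hc'⟩) = z
        rw [g_apply]
        have h1 : (⟨inc k ((θ k).symm (θ k ⟨c', hc'⟩)).1, inc_mem k _ ((θ k).symm (θ k ⟨c', hc'⟩)).2⟩ :
            ↥(((S.t (k + 1)).cond).selmerGroup)) = c := by
          apply Subtype.ext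
          change inc k ((θ k).symm (θ k ⟨c', hc'⟩)).1 = c.1
          rw [AddEquiv.symm_apply_apply]
          exact hinc
        rw [h1, hc, AddEquiv.apply_symm_apply]
  -- `L_k[π] ≃ L_0[π]` for every `k`
  let f : ∀ k, ↥(Submodule.torsionBy R (L k) S.π) ≃ₗ[R] ↥(Submodule.torsionBy R (L 0) S.π) := fun k =>
    Nat.rec (motive := fun k => ↥(Submodule.torsionBy R (L k) S.π) ≃ₗ[R] ↥(Submodule.torsionBy R (L 0) S.π))
      (LinearEquiv.refl R _) (fun k fk => (LinearEquiv.ofBijective (gt k) (gt_bij k)).symm.trans fk) k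
  -- the algebra: Prop. 1.5.5
  obtain ⟨ε₀, hε₀, hiso⟩ :=
    Literature.Algebra.Module.exists_uniform_epsilon_of_torsionBy_linearEquiv hirr hε
      (C := fun k => R ⧸ IsLocalRing.maximalIdeal R ^ S.e k)
      (fun k => Literature.Algebra.Module.finrank_torsionBy_quotient_maximalIdeal_pow hirr (he1 k))
      (M := M) (fun k => LinearEquiv.refl R (L k)) f
  -- back to additive bijections on the Selmer groups
  let e : ∀ k, L k ≃ₗ[R] ((Fin ε₀ → R ⧸ IsLocalRing.maximalIdeal R ^ S.e k) × (M k × M k)) := fun k =>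
    Classical.choice (hiso k)
  refine ⟨ε₀, hε₀, fun k => (θ k).trans (e k).toAddEquiv, fun k r y hy' => ?_⟩
  change e k (θ k ⟨_, _⟩) = r • e k (θ k ⟨y, hy'⟩)
  rw [hθ k r y hy', LinearEquiv.map_smul]

/-! ## §2 The conclusion record from the PER-LEVEL package -/

/-- **Howard 2004, Thm. 1.6.1 — `DVRSetting.Conclusion hy κ.one` from the PER-LEVEL output of Thm. 1.4.2**
(`ε : ℕ → ℕ` with `ε_k ≤ 1`; `θ_k : H¹_F(K, T^{(k)}) ≃ (Fin ε_k → R/𝔪^{e_k}) × (M_k × M_k)` additive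
`R`-equivariant, `M_k` finite), Lemma 1.6.4 at `n = 1` (`κ_1^{(k)} = π^{len M_k} · y_k`) and `κ_1 ≠ 0`, on a
`DVRSetting` with H.0–H.5: §1 (one `ε`) then `DVRSetting.conclusion_of_package`.  `thm161_dvrKolyvaginBound` is
NOT proved here (Thm. 1.4.2 and Lemma 1.6.4 remain printed inputs).
[cite: Howard2004HeegnerKolyvagin, Thm. 1.6.1, proof (arXiv p. 11 L33–38; p. 12 L29–55)] -/
theorem conclusion_of_levelwise_package (S : DVRSetting p K R N Rk Nbar Nq) (κ : S.KolyvaginSystem)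
    (hy : S.SatisfiesH) {ε : ℕ → ℕ} (hε : ∀ k, ε k ≤ 1)
    {M : ℕ → Type} [∀ k, AddCommGroup (M k)] [∀ k, Module R (M k)] [∀ k, Finite (M k)]
    (θ : ∀ k, ↥(((S.t k).cond).selmerGroup) ≃+
      ((Fin (ε k) → R ⧸ IsLocalRing.maximalIdeal R ^ S.e k) × (M k × M k)))
    (hθ : ∀ k (r : R) (y : galoisCohomology (S.T.ρ k) 1) (hy' : y ∈ ((S.t k).cond).selmerGroup),
      θ k ⟨galoisCohomology.scalarMapH1 (S.T.ρ k) (S.T.hlin k) r y,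
          S.scalarMapH1_mem_selmerGroup hy k r hy'⟩ = r • θ k ⟨y, hy'⟩)
    (h164 : ∀ k, ∃ y ∈ ((S.t k).cond).selmerGroup,
      κ.one k = galoisCohomology.scalarMapH1 (S.T.ρ k) (S.T.hlin k)
        (S.π ^ (Module.length R (M k)).toNat) y)
    (hone : κ.one ≠ 0) :
    S.Conclusion hy κ.one := by
  obtain ⟨ε₀, hε₀, θ', hθ'⟩ := S.exists_uniform_package_of_levelwise hy hε θ hθ
  exact S.conclusion_of_package κ hy hε₀ θ' hθ' h164 hone

/-! ## §3 The conclusion record from the EXISTENTIAL per-level statements (the named-fact shapes) -/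

/-- **Howard 2004, Thm. 1.6.1 — `DVRSetting.Conclusion hy κ.one` from the two printed inputs in EXISTENTIAL
per-level form**: (b) «for every level `k` there are `ε ≤ 1`, a finite `R`-module `M` and an additive
`R`-equivariant bijection `H¹_F(K, T^{(k)}) ≃ (Fin ε → R/𝔪^{e_k}) × (M × M)`» (Thm. 1.4.2 / «we may assume
`ε ∈ {0,1}`», at `(T^{(k)}, F)`), and (c) «for every such decomposition at level `k`, `κ_1^{(k)} = π^{len M} · y`
for a Selmer class `y`» (Lemma 1.6.4 at `n = 1`; `len M` and `ε` are invariants of the level, so this is the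
printed statement), plus `κ_1 ≠ 0`, on a `DVRSetting` with H.0–H.5.  This is the shape in which two
Literature named facts for (b) and (c) would make `thm161_dvrKolyvaginBound` a by-name corollary; the fact is
NOT proved here.
[cite: Howard2004HeegnerKolyvagin, Thm. 1.6.1, proof (arXiv p. 11 L33–38; p. 12 L29–55)] -/
theorem conclusion_of_exists_levelwise_package (S : DVRSetting p K R N Rk Nbar Nq) (κ : S.KolyvaginSystem)
    (hy : S.SatisfiesH)
    (h142 : ∀ k, ∃ (ε : ℕ) (_ : ε ≤ 1) (M : Type) (_ : AddCommGroup M) (_ : Module R M) (_ : Finite M)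
      (θ : ↥(((S.t k).cond).selmerGroup) ≃+ ((Fin ε → R ⧸ IsLocalRing.maximalIdeal R ^ S.e k) × (M × M))),
      ∀ (r : R) (y : galoisCohomology (S.T.ρ k) 1) (hy' : y ∈ ((S.t k).cond).selmerGroup),
        θ ⟨galoisCohomology.scalarMapH1 (S.T.ρ k) (S.T.hlin k) r y,
            S.scalarMapH1_mem_selmerGroup hy k r hy'⟩ = r • θ ⟨y, hy'⟩)
    (h164 : ∀ (k : ℕ) (ε : ℕ) (_ : ε ≤ 1) (M : Type) (_ : AddCommGroup M) (_ : Module R M) (_ : Finite M)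
      (θ : ↥(((S.t k).cond).selmerGroup) ≃+ ((Fin ε → R ⧸ IsLocalRing.maximalIdeal R ^ S.e k) × (M × M))),
      (∀ (r : R) (y : galoisCohomology (S.T.ρ k) 1) (hy' : y ∈ ((S.t k).cond).selmerGroup),
        θ ⟨galoisCohomology.scalarMapH1 (S.T.ρ k) (S.T.hlin k) r y,
            S.scalarMapH1_mem_selmerGroup hy k r hy'⟩ = r • θ ⟨y, hy'⟩) →
      ∃ y ∈ ((S.t k).cond).selmerGroup,
        κ.one k = galoisCohomology.scalarMapH1 (S.T.ρ k) (S.T.hlin k)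
          (S.π ^ (Module.length R M).toNat) y)
    (hone : κ.one ≠ 0) :
    S.Conclusion hy κ.one := by
  choose ε hε M instA instM instF θ hθ using h142
  exact S.conclusion_of_levelwise_package κ hy hε θ hθ
    (fun k => h164 k (ε k) (hε k) (M k) (instA k) (instM k) (instF k) (θ k) (hθ k)) hone

/-! ## §4 `ε` and `len_R M` are invariants of the level (Def. 1.5.4 is well posed) -/

/-- **The exponent `ε` and the length `λ^{(k)} = len_R M` of a decomposition
`H¹_F(K, T^{(k)}) ≅ R^{(k),ε} ⊕ M ⊕ M` do not depend on the decomposition** (so Howard's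
`λ^{(k)}(n) := len(M^{(k)}(n))` and `Stub^{(k)}(n) := 𝔪^{λ^{(k)}(n)} H¹_{F(n)}(K, T^{(k)})`, Def. 1.5.4, are well
defined, and the «for EVERY decomposition» typing of Lemma 1.6.4 used by `conclusion_of_exists_levelwise_package`
is equivalent to the printed «for THE decomposition»): two additive `R`-equivariant bijections
`θ_i : H¹_F(K, T^{(k)}) ≃ (Fin ε_i → R/𝔪^{e_k}) × (M_i × M_i)`, `ε_i ≤ 1`, `M_i` finite, have `ε_1 = ε_2`
(Prop. 1.5.5's count `ε + 2·dim M[𝔪] = dim H¹_F[𝔪]`, w7's `eq_of_linearEquiv_pi_prod_prod_self_of_torsionBy_linearEquiv`)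
and `len_R M_1 = len_R M_2` (additivity of length; `len_R (R/𝔪^{e_k}) = e_k`).
[cite: Howard2004HeegnerKolyvagin, Def. 1.5.4 and Prop. 1.5.5 (arXiv Def. 2.5.4 / Prop. 2.5.5, p. 10 L57–75)] -/
theorem epsilon_eq_and_length_eq_of_two_decompositions (S : DVRSetting p K R N Rk Nbar Nq)
    (hy : S.SatisfiesH) (k : ℕ) {ε₁ ε₂ : ℕ} (hε₁ : ε₁ ≤ 1) (hε₂ : ε₂ ≤ 1)
    {M₁ : Type} [AddCommGroup M₁] [Module R M₁] [Finite M₁]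
    {M₂ : Type} [AddCommGroup M₂] [Module R M₂] [Finite M₂]
    (θ₁ : ↥(((S.t k).cond).selmerGroup) ≃+ ((Fin ε₁ → R ⧸ IsLocalRing.maximalIdeal R ^ S.e k) × (M₁ × M₁)))
    (hθ₁ : ∀ (r : R) (y : galoisCohomology (S.T.ρ k) 1) (hy' : y ∈ ((S.t k).cond).selmerGroup),
      θ₁ ⟨galoisCohomology.scalarMapH1 (S.T.ρ k) (S.T.hlin k) r y,
          S.scalarMapH1_mem_selmerGroup hy k r hy'⟩ = r • θ₁ ⟨y, hy'⟩)
    (θ₂ : ↥(((S.t k).cond).selmerGroup) ≃+ ((Fin ε₂ → R ⧸ IsLocalRing.maximalIdeal R ^ S.e k) × (M₂ × M₂)))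
    (hθ₂ : ∀ (r : R) (y : galoisCohomology (S.T.ρ k) 1) (hy' : y ∈ ((S.t k).cond).selmerGroup),
      θ₂ ⟨galoisCohomology.scalarMapH1 (S.T.ρ k) (S.T.hlin k) r y,
          S.scalarMapH1_mem_selmerGroup hy k r hy'⟩ = r • θ₂ ⟨y, hy'⟩) :
    ε₁ = ε₂ ∧ Module.length R M₁ = Module.length R M₂ := by
  have hirr : Irreducible S.π := (IsDiscreteValuationRing.irreducible_iff_uniformizer S.π).mpr hy.unif
  have he1 : 1 ≤ S.e k := hy.e_zero.trans_le (hy.e_strictMono.monotone (Nat.zero_le k))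
  -- the comparison `θ₂ ∘ θ₁⁻¹` is `R`-linear between genuine `R`-modules
  have symm_smul : ∀ (r : R) (y : (Fin ε₁ → R ⧸ IsLocalRing.maximalIdeal R ^ S.e k) × (M₁ × M₁)),
      ((θ₁.symm (r • y) : ↥(((S.t k).cond).selmerGroup)) : galoisCohomology (S.T.ρ k) 1) =
        galoisCohomology.scalarMapH1 (S.T.ρ k) (S.T.hlin k) r
          ((θ₁.symm y : ↥(((S.t k).cond).selmerGroup)) : galoisCohomology (S.T.ρ k) 1) := by
    intro r y
    have h := hθ₁ r (θ₁.symm y).1 (θ₁.symm y).2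
    rw [Subtype.coe_eta, AddEquiv.apply_symm_apply] at h
    have h2 := congrArg θ₁.symm h
    rw [AddEquiv.symm_apply_apply] at h2
    exact (congrArg Subtype.val h2).symm
  let eL : ((Fin ε₁ → R ⧸ IsLocalRing.maximalIdeal R ^ S.e k) × (M₁ × M₁)) ≃ₗ[R]
      ((Fin ε₂ → R ⧸ IsLocalRing.maximalIdeal R ^ S.e k) × (M₂ × M₂)) :=
    { (θ₁.symm.trans θ₂ : _ ≃+ _) with
      map_smul' := fun r y => by
        change θ₂ (θ₁.symm (r • y)) = r • θ₂ (θ₁.symm y)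
        rw [← hθ₂ r _ (θ₁.symm y).2]
        congr 1
        exact Subtype.ext (symm_smul r y) }
  -- `ε₁ = ε₂` (Prop. 1.5.5)
  have hC := Literature.Algebra.Module.finrank_torsionBy_quotient_maximalIdeal_pow hirr he1
  have hε : ε₁ = ε₂ :=
    Literature.Algebra.Module.eq_of_linearEquiv_pi_prod_prod_self_of_torsionBy_linearEquiv hirr hε₁ hε₂
      hC hC (LinearEquiv.refl R _) eL (LinearEquiv.refl R _)
  refine ⟨hε, ?_⟩
  subst hε
  -- lengths: `ε·e_k + 2 len M₁ = ε·e_k + 2 len M₂`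
  haveI : IsArtinian R M₁ := isArtinian_of_finite
  haveI : IsArtinian R M₂ := isArtinian_of_finite
  have hCk : Module.length R (R ⧸ IsLocalRing.maximalIdeal R ^ S.e k) = S.e k := by
    have hI : IsLocalRing.maximalIdeal R ^ S.e k = Ideal.span {1 * S.π ^ S.e k} := by
      rw [one_mul, hy.unif, Ideal.span_singleton_pow]
    rw [(Submodule.quotEquivOfEq _ _ hI).length_eq]
    exact length_quotient_span_unit_mul_uniformizer_pow hirr isUnit_one (S.e k)
  have h := eL.length_eq
  rw [Module.length_prod, Module.length_prod, Module.length_prod, Module.length_prod,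
    Module.length_pi_of_fintype, Finset.sum_const, Finset.card_univ,
    Fintype.card_fin, hCk, ← ENat.coe_toNat (Module.length_ne_top (R := R) (M := M₁)),
    ← ENat.coe_toNat (Module.length_ne_top (R := R) (M := M₂))] at h
  have h' : ε₁ * S.e k + ((Module.length R M₁).toNat + (Module.length R M₁).toNat) =
      ε₁ * S.e k + ((Module.length R M₂).toNat + (Module.length R M₂).toNat) := by
    have h1 : ((ε₁ • (S.e k : ℕ∞)) : ℕ∞) = ((ε₁ * S.e k : ℕ) : ℕ∞) := by
      rw [nsmul_eq_mul]; push_cast; rfl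
    rw [h1] at h
    exact_mod_cast h
  rw [← ENat.coe_toNat (Module.length_ne_top (R := R) (M := M₁)),
    ← ENat.coe_toNat (Module.length_ne_top (R := R) (M := M₂))]
  congr 1
  omega

end DVRSetting

end Literature.NumberTheory.GaloisCohomology.Howard2004
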